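import Mathlib.Algebra.Order.Monoid.Submonoid
import Mathlib.LinearAlgebra.Finsupp.LinearCombination
import Mathlib.GroupTheory.OrderOfElement
import Mathlib.Algebra.Group.Submonoid.Operations
import Mathlib.Data.Fintype.BigOperators
import Mathlib.Algebra.Order.BigOperators.Group.Finset
import Mathlib.Algebra.Group.Pi.Lemmas
import Mathlib.Algebra.Order.Pi
import Mathlib.GroupTheory.Finiteness
import HarnessLib

/-!
# Crux `FrobeniusLadder.FRationalResolution` (stmt-ResolutionOfSingularities-15317), line `redirect`,
# stub `stub_diagonalizableQuotientResolution` — the exponent monoid of the monomial chart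
# `P = {m ∈ ℤⁿ_{≥0} : Σ mᵢ aᵢ = 0}` is FINITELY GENERATED (chart normalisation R4, first brick)

The fixed-point milestone `…FixedPointLogRegular.exists_isLogRegularAt_of_fixed` exhibits, at a
`D(A)`-fixed point, the chart monoid `P = ℤⁿ_{≥0} ⊓ ker (m ↦ Σ mᵢ aᵢ)` (`aᵢ ∈ A` of finite order).
The tree's log atlases (`LogAtlas`, `EtaleLogAtlas`) require finitely generated chart monoids
(field `fg`). This file proves it, elementarily: with `Nᵢ = ord aᵢ`, every `m ∈ P` with some
`mᵢ ≥ Nᵢ` is `Nᵢ eᵢ + m'` with `m' ∈ P`, so `P` is generated by the `Nᵢ eᵢ` and the finitely many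
elements of `P` in the box `∏ [0, Nᵢ)`.

* `fg_nonneg_inf_mker` — `P.FG`.

Honest label: bookkeeping brick (no stub closed). No definitions, no named facts, no sorry.
[folklore; cite: Kato1994, (1.5) (fine monoids)]
-/

-- single-problem summit: the doubled namespace component is forced
set_option linter.dupNamespace false

namespace Summit.ResolutionOfSingularities.ResolutionOfSingularities.Theorems.FRationalResolution.ChartMonoidFG

universe w

/-- **The chart monoid `P = {m ∈ ℤⁿ : m ≥ 0, Σ mᵢ aᵢ = 0}` is finitely generated** when every `aᵢ`
has finite order: it is generated by the `(ord aᵢ) eᵢ` and its elements in the box `∏ᵢ [0, ord aᵢ)`.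
[folklore; cite: Kato1994, (1.5)] -/
theorem fg_nonneg_inf_mker {A : Type w} [AddCommGroup A] {n : ℕ} (a : Fin n → A)
    (ha : ∀ i, IsOfFinAddOrder (a i)) :
    (AddSubmonoid.nonneg (Fin n → ℤ) ⊓
      AddMonoidHom.mker (Fintype.linearCombination ℤ a).toAddMonoidHom).FG := by
  classical
  set P : AddSubmonoid (Fin n → ℤ) := AddSubmonoid.nonneg (Fin n → ℤ) ⊓
    AddMonoidHom.mker (Fintype.linearCombination ℤ a).toAddMonoidHom with hP
  have hmemP : ∀ m : Fin n → ℤ, m ∈ P ↔ (0 ≤ m ∧ ∑ i, m i • a i = 0) := fun m => by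
    rw [hP, AddSubmonoid.mem_inf, AddSubmonoid.mem_nonneg, AddMonoidHom.mem_mker,
      LinearMap.toAddMonoidHom_coe, Fintype.linearCombination_apply]
  let N : Fin n → ℕ := fun i => addOrderOf (a i)
  have hNpos : ∀ i, 0 < N i := fun i => (ha i).addOrderOf_pos
  -- the generators: `N i • e_i` and the box elements of `P`
  let single : Fin n → (Fin n → ℤ) := fun i => Pi.single i (N i : ℤ)
  let box : Finset (Fin n → ℤ) :=
    ((Fintype.piFinset fun i => Finset.range (N i)).image fun m i => (m i : ℤ)).filter (· ∈ P)
  let G : Finset (Fin n → ℤ) := Finset.univ.image single ∪ box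
  have hsingle : ∀ i, single i ∈ P := fun i => by
    rw [hmemP]
    refine ⟨fun j => ?_, ?_⟩
    · by_cases hj : j = i
      · subst hj; simp [single]
      · simp [single, hj]
    · simp only [single, Pi.single_apply, ite_smul, zero_smul, Finset.sum_ite_eq',
        Finset.mem_univ, if_true, natCast_zsmul]
      exact addOrderOf_nsmul_eq_zero (a i)
  have hGP : (G : Set (Fin n → ℤ)) ⊆ P := by
    intro m hm
    rw [Finset.mem_coe, Finset.mem_union] at hm
    rcases hm with hm | hm
    · obtain ⟨i, -, rfl⟩ := Finset.mem_image.mp hm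
      exact hsingle i
    · exact (Finset.mem_filter.mp hm).2
  refine ⟨G, le_antisymm (AddSubmonoid.closure_le.mpr hGP) ?_⟩
  -- every element of `P` is generated: induction on the total degree
  suffices h : ∀ d : ℕ, ∀ m ∈ P, ∑ i, (m i).toNat = d → m ∈ AddSubmonoid.closure (G : Set (Fin n → ℤ)) by
    intro m hm
    exact h _ m hm rfl
  intro d
  induction d using Nat.strong_induction_on with
  | _ d ih =>
    intro m hm hd
    obtain ⟨hm0, hdeg⟩ := (hmemP m).mp hm
    by_cases hbox : ∀ i, m i < N i
    · -- `m` is a box element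
      refine AddSubmonoid.subset_closure (Finset.mem_union_right _ ?_)
      refine Finset.mem_filter.mpr ⟨Finset.mem_image.mpr ⟨fun i => (m i).toNat, ?_, ?_⟩, hm⟩
      · refine Fintype.mem_piFinset.mpr fun i => Finset.mem_range.mpr ?_
        have h0 : (0 : ℤ) ≤ m i := hm0 i
        have h1 := hbox i
        omega
      · funext i
        exact Int.toNat_of_nonneg (hm0 i)
    · push Not at hbox
      obtain ⟨i, hi⟩ := hbox
      -- split off `N i • e_i`
      set m' : Fin n → ℤ := m - single i with hm'
      have hm'0 : 0 ≤ m' := fun j => by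
        by_cases hj : j = i
        · subst hj
          simp only [m', single, Pi.sub_apply, Pi.single_eq_same, Pi.zero_apply]
          omega
        · have h0 : (0 : ℤ) ≤ m j := hm0 j
          simp only [m', single, Pi.sub_apply, Pi.single_eq_of_ne hj, sub_zero, Pi.zero_apply]
          exact h0
      have hm'P : m' ∈ P := by
        rw [hmemP]
        refine ⟨hm'0, ?_⟩
        have hs := ((hmemP _).mp (hsingle i)).2
        simp only [m', Pi.sub_apply, sub_smul, Finset.sum_sub_distrib, hdeg, hs, sub_zero]
      have hlt : ∑ j, (m' j).toNat < d := by
        rw [← hd]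
        have hle : ∀ j ∈ (Finset.univ : Finset (Fin n)), (m' j).toNat ≤ (m j).toNat :=
          fun j _ => by
          by_cases hj : j = i
          · subst hj
            simp only [m', single, Pi.sub_apply, Pi.single_eq_same]
            omega
          · simp only [m', single, Pi.sub_apply, Pi.single_eq_of_ne hj, sub_zero, le_refl]
        have hlti : (m' i).toNat < (m i).toNat := by
          have h1 := hNpos i
          simp only [m', single, Pi.sub_apply, Pi.single_eq_same]
          omega
        exact Finset.sum_lt_sum hle ⟨i, Finset.mem_univ i, hlti⟩
      have hm'cl := ih _ hlt m' hm'P rfl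
      have hmeq : m = single i + m' := by simp [m']
      rw [hmeq]
      exact AddSubmonoid.add_mem _
        (AddSubmonoid.subset_closure (Finset.mem_union_left _
          (Finset.mem_image.mpr ⟨i, Finset.mem_univ i, rfl⟩))) hm'cl

end Summit.ResolutionOfSingularities.ResolutionOfSingularities.Theorems.FRationalResolution.ChartMonoidFG
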